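import Mathlib
import HarnessLib
import Literature.Analysis.FluidPDE.OseenMildUniqueness
import Literature.Analysis.FluidPDE.OseenZoomCovariance
import Literature.Analysis.FluidPDE.KNSSOseenMildDecayTools
import Literature.Analysis.FluidPDE.KNSSSmoothingHolds
import Literature.Analysis.FluidPDE.TypeIAncientMildRssPullback
import Summits.NavierStokesRegularity.NavierStokesRegularity.Theorems.UnthreadedRigidityDoorUnthreadedRigidityVirialHornDefs

/-!
# Route `UnthreadedRigidityDoor`, item `UnthreadedRigidity` (W2, stmt-NavierStokesRegularity-27585) — LINE g11-1 «VIRIAL HORN»: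
# support S-U `WindowAxisUniform` («COMMON AXIS») PROVED

`theorem windowAxisUniform_holds : WindowAxisUniform` (Defs twin `…Theorems.UnthreadedRigidity.VirialHorn`, p695782; statement
verbatim g10-1 / g11-1, author planner ns-idea-6): in a window `S` (open, preconnected) of a bounded Oseen-mild field `u` whose
every slice is axisymmetric about SOME axis through `x₀` (a skew generator `A_t ≠ 0` with `D(u t)(x)·A_t(x − x₀) = A_t u(t,x)`),
ONE generator works for all `t ∈ S`.  PROOF (forward uniqueness only, as the PressureHorn CARD §S-U says; its «two axes ⇒
zero slice» step is not needed): (1) slices are `C¹` in the open window — `u` IS the canonical representative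
`e^{(t−s)Δ}u(s) − B¹ₛ(u,u)(t)` on `(s,T') ∋ t`, jointly smooth by `knss2009_smoothing_holds` (`window_differentiable_slice`);
(2) for a differentiable slice, `Df(x)·A(x − x₀) = A f(x) ∀x` iff `f(e^{θA}y + x₀) = e^{θA} f(y + x₀) ∀θ,y`
(`equivariant_exp_of_fderiv`: `ψ(r) = e^{(θ−r)A} f(e^{rA}y + x₀)` is constant; `fderiv_eq_of_equivariant_exp`: differentiate
at `θ = 0`); (3) a finite symmetry `u(s, Ry + x₀) = R u(s, y + x₀)` (`R` a linear isometry) propagates to every later slice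
(`window_equivariance_transport`): `v = u(·, · + x₀)` and `w = R⁻¹ v(·, R ·)` solve the SAME Oseen equation on `(s,T')`
(covariance lemmas `heatExtension_comp_add_left`, `oseenDuhamel_comp_add_right`, `heatExtension_conj_linearIsometryEquiv`,
`oseenDuhamel_symm_conj_linearIsometryEquiv`) from the same slice, so agree a.e. by `oseenMild_bounded_unique` and
everywhere by continuity; for skew `A`, `e^{θA}` is a linear isometry (`rss_exists_rot`); (4) hence the symmetry algebras
`𝔞_t = {A skew : D(u t)·A(· − x₀) = A u(t)}` (subspaces of `E3 →L[ℝ] E3`, `exists_symAlg`) increase with `t` and are all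
non-zero, so the one of least `finrank` lies in all of them (`exists_submodule_le_all`); its hypothesis generator is the
common `A` (`S = ∅`: `exists_skew_ne_zero`).

HONEST LABEL: a support (S–M) of one RUNG line — axis bookkeeping for slicewise-axisymmetric windows; `UnthreadedRigidity`
(27585), W2 and NS regularity remain OPEN; nothing here is a statement about regularity of Navier–Stokes solutions.
`--supports stmt-NavierStokesRegularity-27585` (helper).  Filed by ns-crc-p2 g8 (second seat of the crc base, under the W2 hand
ns-crc-p1).  [cite: KochNadirashviliSereginSverak2009, §4 (uniqueness and smoothing of bounded mild solutions); MajdaBertozziCUP2002,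
§1.2 Prop. 1.1 (iii) (rotation symmetry)]
-/

-- the summit and its single sub-problem share the name (CONVENTIONS §1)
set_option linter.dupNamespace false

namespace Summit.NavierStokesRegularity.NavierStokesRegularity.Theorems.UnthreadedRigidity.VirialHorn

open scoped Topology
open Filter Set MeasureTheory Function
open Summit.NavierStokesRegularity.NavierStokesRegularity.Theorems.UnthreadedRigidity.ProfileHorn (E3 IsSliceAxisymmetric)
open Literature.Analysis.FluidPDE Literature.Analysis.UnboundedOperators

/-! ## §1 The flow `e^{θA}`: infinitesimal versus finite equivariance of a differentiable slice -/

/-- The orbit `r ↦ e^{rA} y + x₀` has velocity `A e^{rA} y`. [folklore] -/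
theorem hasDerivAt_exp_smul_apply_add (A : E3 →L[ℝ] E3) (y x₀ : E3) (θ : ℝ) :
    HasDerivAt (fun r : ℝ => NormedSpace.exp (r • A) y + x₀) (A (NormedSpace.exp (θ • A) y)) θ := by
  have h : HasDerivAt (fun r : ℝ => NormedSpace.exp (r • A) y) (A (NormedSpace.exp (θ • A) y)) θ := by
    simpa using (hasDerivAt_exp_smul_const' (𝕂 := ℝ) A θ).clm_apply (hasDerivAt_const θ y)
  exact h.add_const x₀

/-- INFINITESIMAL ⇒ FINITE EQUIVARIANCE: a differentiable field `f` with `Df(x)·A(x − x₀) = A f(x)` for every `x`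
satisfies `f(e^{θA}y + x₀) = e^{θA} f(y + x₀)` (`ψ(r) = e^{(θ−r)A} f(e^{rA}y + x₀)` is constant; no skewness needed). [folklore] -/
theorem equivariant_exp_of_fderiv {f : E3 → E3} (hf : Differentiable ℝ f) {A : E3 →L[ℝ] E3} {x₀ : E3}
    (hA : ∀ x, fderiv ℝ f x (A (x - x₀)) - A (f x) = 0) (θ : ℝ) (y : E3) :
    f (NormedSpace.exp (θ • A) y + x₀) = NormedSpace.exp (θ • A) (f (y + x₀)) := by
  set ψ : ℝ → E3 := fun r => NormedSpace.exp ((θ - r) • A) (f (NormedSpace.exp (r • A) y + x₀)) with hψ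
  have hderiv : ∀ r, HasDerivAt ψ 0 r := by
    intro r
    have hE : HasDerivAt (fun r : ℝ => NormedSpace.exp ((θ - r) • A))
        (-(A * NormedSpace.exp ((θ - r) • A))) r := by
      have h1 := (hasDerivAt_exp_smul_const' (𝕂 := ℝ) A (θ - r)).scomp r ((hasDerivAt_id r).const_sub θ)
      simpa [Function.comp_def] using h1
    have hX := hasDerivAt_exp_smul_apply_add A y x₀ r
    have hF : HasDerivAt (fun r : ℝ => f (NormedSpace.exp (r • A) y + x₀))
        (fderiv ℝ f (NormedSpace.exp (r • A) y + x₀) (A (NormedSpace.exp (r • A) y))) r :=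
      (hf _).hasFDerivAt.comp_hasDerivAt r hX
    have hprod := hE.clm_apply hF
    have hkey : fderiv ℝ f (NormedSpace.exp (r • A) y + x₀) (A (NormedSpace.exp (r • A) y)) =
        A (f (NormedSpace.exp (r • A) y + x₀)) := by
      have h := hA (NormedSpace.exp (r • A) y + x₀)
      rw [add_sub_cancel_right] at h
      exact sub_eq_zero.1 h
    rw [hkey] at hprod
    have hc : Commute A ((θ - r) • A) := by
      change A * ((θ - r) • A) = ((θ - r) • A) * A
      ext z
      simp
    have hcomm : Commute A (NormedSpace.exp ((θ - r) • A)) := hc.exp_right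
    refine hprod.congr_deriv ?_
    rw [neg_apply, mul_apply_eq_comp,
      show NormedSpace.exp ((θ - r) • A) (A (f (NormedSpace.exp (r • A) y + x₀))) =
          A (NormedSpace.exp ((θ - r) • A) (f (NormedSpace.exp (r • A) y + x₀))) by
        rw [← mul_apply_eq_comp, ← hcomm.eq, mul_apply_eq_comp],
      neg_add_cancel]
  have hconst := is_const_of_deriv_eq_zero (fun r => (hderiv r).differentiableAt)
    (fun r => (hderiv r).deriv) θ 0
  have h0 : NormedSpace.exp ((0 : ℝ) • A) = 1 := by rw [zero_smul ℝ A, NormedSpace.exp_zero]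
  simp only [hψ, sub_self, sub_zero, h0, one_apply_eq_self] at hconst
  exact hconst

/-- FINITE ⇒ INFINITESIMAL EQUIVARIANCE: if the differentiable field `f` satisfies `f(e^{θA}y + x₀) = e^{θA} f(y + x₀)`
for all `θ, y`, then `Df(x)·A(x − x₀) = A f(x)` (differentiate at `θ = 0`). [folklore] -/
theorem fderiv_eq_of_equivariant_exp {f : E3 → E3} (hf : Differentiable ℝ f) {A : E3 →L[ℝ] E3} {x₀ : E3}
    (h : ∀ (θ : ℝ) (y : E3), f (NormedSpace.exp (θ • A) y + x₀) = NormedSpace.exp (θ • A) (f (y + x₀)))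
    (x : E3) : fderiv ℝ f x (A (x - x₀)) - A (f x) = 0 := by
  set y : E3 := x - x₀ with hy
  have hx : y + x₀ = x := sub_add_cancel x x₀
  have h0 : NormedSpace.exp ((0 : ℝ) • A) = 1 := by rw [zero_smul ℝ A, NormedSpace.exp_zero]
  have h1 : HasDerivAt (fun r : ℝ => f (NormedSpace.exp (r • A) y + x₀))
      (fderiv ℝ f (NormedSpace.exp ((0 : ℝ) • A) y + x₀) (A (NormedSpace.exp ((0 : ℝ) • A) y))) 0 :=
    (hf _).hasFDerivAt.comp_hasDerivAt 0 (hasDerivAt_exp_smul_apply_add A y x₀ 0)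
  rw [h0, one_apply_eq_self, hx] at h1
  have h2 := (hasDerivAt_exp_smul_const' (𝕂 := ℝ) A (0 : ℝ)).clm_apply
    (hasDerivAt_const (0 : ℝ) (f (y + x₀)))
  rw [h0, mul_one, map_zero, add_zero, hx] at h2
  have heq : (fun r : ℝ => f (NormedSpace.exp (r • A) y + x₀)) =
      fun r : ℝ => NormedSpace.exp (r • A) (f (y + x₀)) := funext fun r => h r y
  rw [heq, hx] at h1
  have huniq := h1.unique h2
  rw [huniq, sub_self]

/-! ## §2 Windows of bounded Oseen-mild fields: smooth slices and forward transport of a rotational symmetry -/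

/-- In an open set of times, every `t ∈ S` has some room above: `Icc t T' ⊆ S` with `t < T'`. [folklore] -/
theorem exists_gt_Icc_subset {S : Set ℝ} (hS : IsOpen S) {t : ℝ} (ht : t ∈ S) :
    ∃ T' : ℝ, t < T' ∧ Icc t T' ⊆ S := by
  obtain ⟨ε, hε, hball⟩ := Metric.isOpen_iff.1 hS t ht
  refine ⟨t + ε / 2, by linarith, fun r hr => hball ?_⟩
  rw [Metric.mem_ball, Real.dist_eq, abs_lt]
  constructor <;> linarith [hr.1, hr.2]

/-- In an open set of times, every `t ∈ S` has some room below: `Icc s t ⊆ S` with `s < t`. [folklore] -/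
theorem exists_lt_Icc_subset {S : Set ℝ} (hS : IsOpen S) {t : ℝ} (ht : t ∈ S) :
    ∃ s : ℝ, s < t ∧ Icc s t ⊆ S := by
  obtain ⟨ε, hε, hball⟩ := Metric.isOpen_iff.1 hS t ht
  refine ⟨t - ε / 2, by linarith, fun r hr => hball ?_⟩
  rw [Metric.mem_ball, Real.dist_eq, abs_lt]
  constructor <;> linarith [hr.1, hr.2]

/-- SLICES OF A WINDOW ARE DIFFERENTIABLE.  For a jointly continuous, locally-in-time bounded field on an open time
set `S` satisfying the Oseen integral identity pointwise between any two times of `S`, every slice `u t`, `t ∈ S`, is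
differentiable (indeed `C^∞`): `u` coincides on `(s, T') ∋ t` with the canonical representative
`e^{(·−s)Δ}u(s) − B¹ₛ(u,u)`, jointly smooth by KNSS smoothing (`knss2009_smoothing_holds`). [cite: KochNadirashviliSereginSverak2009, Prop. 4.1 (arXiv:0709.3599 p. 8)] -/
theorem window_differentiable_slice {S : Set ℝ} (hS : IsOpen S) {u : ℝ → E3 → E3}
    (hcont : ContinuousOn (uncurry u) (S ×ˢ univ))
    (hmild : ∀ s ∈ S, ∀ t ∈ S, s < t → ∀ x, u t x =
        heatExtension (u s) (t - s) x - oseenDuhamel 1 s u u t x)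
    (hbdd : ∀ τ ∈ S, ∃ B : ℝ, ∀ t ∈ S, t ≤ τ → ∀ x, ‖u t x‖ ≤ B)
    {t : ℝ} (ht : t ∈ S) : Differentiable ℝ (u t) := by
  obtain ⟨s, hst, hsI⟩ := exists_lt_Icc_subset hS ht
  obtain ⟨T', htT', htI⟩ := exists_gt_Icc_subset hS ht
  have hsS : s ∈ S := hsI ⟨le_rfl, hst.le⟩
  have hT'S : T' ∈ S := htI ⟨htT'.le, le_rfl⟩
  have hIoo : Ioo s T' ⊆ S := fun r hr => by
    rcases le_or_gt r t with h | h
    · exact hsI ⟨hr.1.le, h⟩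
    · exact htI ⟨h.le, hr.2.le⟩
  obtain ⟨B, hB⟩ := hbdd T' hT'S
  have hM0 : (0 : ℝ) ≤ max B 0 := le_max_right _ _
  have hbound : ∀ τ ∈ S, τ ≤ T' → ∀ x, ‖u τ x‖ ≤ max B 0 :=
    fun τ hτ hle x => (hB τ hτ hle x).trans (le_max_left _ _)
  have hslice : ∀ τ ∈ S, Continuous (u τ) := fun τ hτ =>
    hcont.comp_continuous (continuous_const.prodMk continuous_id) fun x => ⟨hτ, mem_univ _⟩
  have ha : AEStronglyMeasurable (u s) volume := (hslice s hsS).aestronglyMeasurable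
  have haM : eLpNorm (u s) ⊤ volume ≤ ENNReal.ofReal (max B 0) := by
    rw [eLpNorm_exponent_top]
    exact eLpNormEssSup_le_of_ae_bound
      (Eventually.of_forall fun x => hbound s hsS (hst.le.trans htT'.le) x)
  have hum : AEStronglyMeasurable (uncurry u) (volume.restrict (Ioo s T' ×ˢ univ)) :=
    (hcont.mono (prod_mono hIoo Subset.rfl)).aestronglyMeasurable
      (measurableSet_Ioo.prod MeasurableSet.univ)
  have huM : ∀ τ ∈ Ioo s T', eLpNorm (u τ) ⊤ volume ≤ ENNReal.ofReal (max B 0) := fun τ hτ => by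
    rw [eLpNorm_exponent_top]
    exact eLpNormEssSup_le_of_ae_bound (Eventually.of_forall fun x => hbound τ (hIoo hτ) hτ.2.le x)
  have husol : ∀ τ ∈ Ioo s T', u τ =ᵐ[volume] fun x =>
      heatExtension (u s) (1 * (τ - s)) x - oseenDuhamel 1 s u u τ x := fun τ hτ =>
    Eventually.of_forall fun x => by rw [one_mul]; exact hmild s hsS τ (hIoo hτ) hτ.1 x
  obtain ⟨hsm, -, -⟩ :=
    knss2009_smoothing_holds E3 one_pos (hst.trans htT') hM0 ha haM hum huM husol
  have hcd := hsm.contDiff_slice (t := t) ⟨hst, htT'⟩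
  have hd : Differentiable ℝ (fun x => heatExtension (u s) (1 * (t - s)) x - oseenDuhamel 1 s u u t x) :=
    (contDiff_infty.1 hcd 1).differentiable (by simp)
  have heq : (fun x => heatExtension (u s) (1 * (t - s)) x - oseenDuhamel 1 s u u t x) = u t := by
    funext x
    rw [one_mul]
    exact (hmild s hsS t ht hst x).symm
  rw [heq] at hd
  exact hd

/-- FORWARD TRANSPORT OF A ROTATIONAL SYMMETRY (Majda–Bertozzi 2002, Prop. 1.1 (iii) + KNSS forward uniqueness).  In a
window as above (open, preconnected time set), if the slice `u s` is equivariant about `x₀` under a linear isometry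
`R` — `u(s, Ry + x₀) = R u(s, y + x₀)` — then so is every later slice `u t`, `t ∈ S`, `s < t`: the translated field
`v = u(·, · + x₀)` and its conjugate `w = R⁻¹ v(·, R ·)` solve the same Oseen equation from the same slice on `(s,T')`,
both bounded and continuous, hence agree (`oseenMild_bounded_unique`, continuity). [cite: KochNadirashviliSereginSverak2009, §4 (4.3)–(4.4) (arXiv:0709.3599 p. 8)] -/
theorem window_equivariance_transport {S : Set ℝ} (hS : IsOpen S) (hconn : IsPreconnected S)
    {u : ℝ → E3 → E3} {x₀ : E3} (hcont : ContinuousOn (uncurry u) (S ×ˢ univ))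
    (hmild : ∀ s ∈ S, ∀ t ∈ S, s < t → ∀ x, u t x =
        heatExtension (u s) (t - s) x - oseenDuhamel 1 s u u t x)
    (hbdd : ∀ τ ∈ S, ∃ B : ℝ, ∀ t ∈ S, t ≤ τ → ∀ x, ‖u t x‖ ≤ B)
    (R : E3 ≃ₗᵢ[ℝ] E3) {s t : ℝ} (hs : s ∈ S) (ht : t ∈ S) (hst : s < t)
    (hsym : ∀ y, u s (R y + x₀) = R (u s (y + x₀))) (y : E3) :
    u t (R y + x₀) = R (u t (y + x₀)) := by
  obtain ⟨T', htT', htI⟩ := exists_gt_Icc_subset hS ht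
  have hT'S : T' ∈ S := htI ⟨htT'.le, le_rfl⟩
  have hIcc : Icc s t ⊆ S := hconn.Icc_subset hs ht
  have hIoo : Ioo s T' ⊆ S := fun r hr => by
    rcases le_or_gt r t with h | h
    · exact hIcc ⟨hr.1.le, h⟩
    · exact htI ⟨h.le, hr.2.le⟩
  obtain ⟨B, hB⟩ := hbdd T' hT'S
  have hM0 : (0 : ℝ) ≤ max B 0 := le_max_right _ _
  have hbound : ∀ τ ∈ Ioo s T', ∀ x, ‖u τ x‖ ≤ max B 0 :=
    fun τ hτ x => (hB τ (hIoo hτ) hτ.2.le x).trans (le_max_left _ _)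
  obtain ⟨v, hv⟩ : ∃ v : ℝ → E3 → E3, v = fun τ z => u τ (z + x₀) := ⟨_, rfl⟩
  obtain ⟨w, hw⟩ : ∃ w : ℝ → E3 → E3, w = fun τ z => R.symm (v τ (R z)) := ⟨_, rfl⟩
  have hws : w s = v s := by
    funext z
    simp only [hw, hv, hsym z, LinearIsometryEquiv.symm_apply_apply]
  -- the Oseen identity for `v` on `(s, T')`
  have hvmild : ∀ τ ∈ Ioo s T', ∀ z, v τ z =
      heatExtension (v s) (τ - s) z - oseenDuhamel 1 s v v τ z := by
    intro τ hτ z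
    have h1 : heatExtension (v s) (τ - s) z = heatExtension (u s) (τ - s) (z + x₀) := by
      have e : v s = fun z' => u s (x₀ + z') := by
        funext z'
        simp only [hv, add_comm]
      rw [e, heatExtension_comp_add_left, add_comm]
    have h2 : oseenDuhamel 1 s v v τ z = oseenDuhamel 1 s u u τ (z + x₀) := by
      rw [hv]
      exact oseenDuhamel_comp_add_right 1 s u u x₀ τ z
    rw [h1, h2, hv]
    exact hmild s hs τ (hIoo hτ) hτ.1 (z + x₀)
  -- the Oseen identity for `w` on `(s, T')`, with the SAME free term
  have hwmild : ∀ τ ∈ Ioo s T', ∀ z, w τ z =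
      heatExtension (v s) (τ - s) z - oseenDuhamel 1 s w w τ z := by
    intro τ hτ z
    have h1 : heatExtension (w s) (τ - s) z = R.symm (heatExtension (v s) (τ - s) (R z)) := by
      have e : w s = fun z' => R.symm (v s (R.symm.symm z')) := by
        funext z'
        simp only [hw, LinearIsometryEquiv.symm_symm]
      rw [e, heatExtension_conj_linearIsometryEquiv, LinearIsometryEquiv.symm_symm]
    have h2 : oseenDuhamel 1 s w w τ z = R.symm (oseenDuhamel 1 s v v τ (R z)) := by
      rw [hw]
      exact oseenDuhamel_symm_conj_linearIsometryEquiv R 1 s v v τ z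
    rw [← hws, h1, h2, ← map_sub, ← hvmild τ hτ (R z), hw]
  have hvc : ContinuousOn (uncurry v) (Ioo s T' ×ˢ univ) := by
    have hφ : Continuous fun p : ℝ × E3 => (p.1, p.2 + x₀) := by fun_prop
    have hmaps : MapsTo (fun p : ℝ × E3 => (p.1, p.2 + x₀)) (Ioo s T' ×ˢ univ) (S ×ˢ univ) :=
      fun p hp => ⟨hIoo hp.1, mem_univ _⟩
    have hcomp := hcont.comp hφ.continuousOn hmaps
    rw [hv]
    exact hcomp
  have hwc : ContinuousOn (uncurry w) (Ioo s T' ×ˢ univ) := by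
    have hφ : Continuous fun p : ℝ × E3 => (p.1, R p.2) := by fun_prop
    have hmaps : MapsTo (fun p : ℝ × E3 => (p.1, R p.2)) (Ioo s T' ×ˢ univ) (Ioo s T' ×ˢ univ) :=
      fun p hp => ⟨hp.1, mem_univ _⟩
    have hcomp := R.symm.continuous.comp_continuousOn (hvc.comp hφ.continuousOn hmaps)
    rw [hw]
    exact hcomp
  have hvm : AEStronglyMeasurable (uncurry v)
      ((volume : Measure (ℝ × E3)).restrict (Ioo s T' ×ˢ univ)) :=
    hvc.aestronglyMeasurable (measurableSet_Ioo.prod MeasurableSet.univ)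
  have hwm : AEStronglyMeasurable (uncurry w)
      ((volume : Measure (ℝ × E3)).restrict (Ioo s T' ×ˢ univ)) :=
    hwc.aestronglyMeasurable (measurableSet_Ioo.prod MeasurableSet.univ)
  have hvM : ∀ τ ∈ Ioo s T', ∀ z, ‖v τ z‖ ≤ max B 0 := fun τ hτ z => by
    rw [hv]
    exact hbound τ hτ (z + x₀)
  have hwM : ∀ τ ∈ Ioo s T', ∀ z, ‖w τ z‖ ≤ max B 0 := fun τ hτ z => by
    rw [hw]
    simp only [LinearIsometryEquiv.norm_map]
    exact hvM τ hτ (R z)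
  have hvsol : ∀ τ ∈ Ioo s T', v τ =ᵐ[volume] fun z =>
      heatExtension (v s) (τ - s) z - oseenDuhamel 1 s v v τ z :=
    fun τ hτ => Eventually.of_forall (hvmild τ hτ)
  have hwsol : ∀ τ ∈ Ioo s T', w τ =ᵐ[volume] fun z =>
      heatExtension (v s) (τ - s) z - oseenDuhamel 1 s w w τ z :=
    fun τ hτ => Eventually.of_forall (hwmild τ hτ)
  have huniq := oseenMild_bounded_unique (E := E3) (U := fun τ z => heatExtension (v s) (τ - s) z)
    one_pos hM0 hvm hwm hvM hwM hvsol hwsol t ⟨hst, htT'⟩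
  have hvt : Continuous (v t) :=
    hvc.comp_continuous (continuous_const.prodMk continuous_id) fun z => ⟨⟨hst, htT'⟩, mem_univ _⟩
  have hwt : Continuous (w t) :=
    hwc.comp_continuous (continuous_const.prodMk continuous_id) fun z => ⟨⟨hst, htT'⟩, mem_univ _⟩
  have heq : v t = w t := Measure.eq_of_ae_eq huniq hvt hwt
  have hy := congrFun heq y
  simp only [hw, hv] at hy
  calc u t (R y + x₀) = R (R.symm (u t (R y + x₀))) := (R.apply_symm_apply _).symm
    _ = R (u t (y + x₀)) := by rw [← hy]

/-! ## §3 Linear algebra: symmetry algebras and the minimal one -/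

/-- The SYMMETRY ALGEBRA of a slice about `x₀` — the skew generators `A` with `Df(x)·A(x − x₀) = A f(x)` for all `x` —
is a linear subspace of `E3 →L[ℝ] E3` (both conditions are linear in `A`). [folklore] -/
theorem exists_symAlg (f : E3 → E3) (x₀ : E3) :
    ∃ 𝔞 : Submodule ℝ (E3 →L[ℝ] E3), ∀ A : E3 →L[ℝ] E3, A ∈ 𝔞 ↔
      ((∀ x, inner ℝ (A x) x = 0) ∧ ∀ x, fderiv ℝ f x (A (x - x₀)) - A (f x) = 0) := by
  have hadd : ∀ {A B : E3 →L[ℝ] E3},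
      A ∈ {A : E3 →L[ℝ] E3 | (∀ x, inner ℝ (A x) x = 0) ∧ ∀ x, fderiv ℝ f x (A (x - x₀)) - A (f x) = 0} →
      B ∈ {A : E3 →L[ℝ] E3 | (∀ x, inner ℝ (A x) x = 0) ∧ ∀ x, fderiv ℝ f x (A (x - x₀)) - A (f x) = 0} →
      A + B ∈ {A : E3 →L[ℝ] E3 | (∀ x, inner ℝ (A x) x = 0) ∧
        ∀ x, fderiv ℝ f x (A (x - x₀)) - A (f x) = 0} := by
    rintro A B ⟨hA1, hA2⟩ ⟨hB1, hB2⟩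
    refine ⟨fun x => ?_, fun x => ?_⟩
    · simp only [add_apply, inner_add_left, hA1, hB1, add_zero]
    · have hA := hA2 x
      have hB := hB2 x
      simp only [add_apply, map_add]
      rw [sub_eq_zero] at hA hB ⊢
      rw [hA, hB]
  have hsmul : ∀ (c : ℝ) {A : E3 →L[ℝ] E3},
      A ∈ {A : E3 →L[ℝ] E3 | (∀ x, inner ℝ (A x) x = 0) ∧ ∀ x, fderiv ℝ f x (A (x - x₀)) - A (f x) = 0} →
      c • A ∈ {A : E3 →L[ℝ] E3 | (∀ x, inner ℝ (A x) x = 0) ∧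
        ∀ x, fderiv ℝ f x (A (x - x₀)) - A (f x) = 0} := by
    rintro c A ⟨hA1, hA2⟩
    refine ⟨fun x => ?_, fun x => ?_⟩
    · simp only [smul_apply, real_inner_smul_left, hA1, mul_zero]
    · have hA := hA2 x
      simp only [smul_apply, map_smul]
      rw [sub_eq_zero] at hA ⊢
      rw [hA]
  have hzero : (0 : E3 →L[ℝ] E3) ∈ {A : E3 →L[ℝ] E3 | (∀ x, inner ℝ (A x) x = 0) ∧
      ∀ x, fderiv ℝ f x (A (x - x₀)) - A (f x) = 0} := ⟨fun x => by simp, fun x => by simp⟩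
  exact ⟨{ carrier := {A | (∀ x, inner ℝ (A x) x = 0) ∧ ∀ x, fderiv ℝ f x (A (x - x₀)) - A (f x) = 0}
           add_mem' := hadd
           zero_mem' := hzero
           smul_mem' := hsmul }, fun A => Iff.rfl⟩

/-- A family of subspaces of a finite-dimensional real vector space, indexed by a nonempty set of reals and monotone in
the index, has a member contained in all the others (the member of least dimension). [folklore] -/
theorem exists_submodule_le_all {V : Type*} [AddCommGroup V] [Module ℝ V] [FiniteDimensional ℝ V]
    {S : Set ℝ} (hne : S.Nonempty) (𝔞 : ℝ → Submodule ℝ V)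
    (hmono : ∀ a ∈ S, ∀ b ∈ S, a ≤ b → 𝔞 a ≤ 𝔞 b) :
    ∃ a ∈ S, ∀ b ∈ S, 𝔞 a ≤ 𝔞 b := by
  classical
  have hex : ∃ n : ℕ, ∃ a ∈ S, Module.finrank ℝ (𝔞 a) = n := by
    obtain ⟨a, ha⟩ := hne
    exact ⟨_, a, ha, rfl⟩
  obtain ⟨a, ha, hfa⟩ := Nat.find_spec hex
  refine ⟨a, ha, fun b hb => ?_⟩
  rcases le_total a b with hab | hba
  · exact hmono a ha b hb hab
  · have hle : 𝔞 b ≤ 𝔞 a := hmono b hb a ha hba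
    have hfin : Module.finrank ℝ (𝔞 a) ≤ Module.finrank ℝ (𝔞 b) := by
      rw [hfa]
      exact Nat.find_min' hex ⟨b, hb, rfl⟩
    exact (Submodule.eq_of_le_of_finrank_le hle hfin).ge

/-- There is a non-zero skew endomorphism of `ℝ³` (the generator `y ↦ ⟪e₀,y⟫e₁ − ⟪e₁,y⟫e₀` of the rotations about `e₂`).
[folklore] -/
theorem exists_skew_ne_zero :
    ∃ A : E3 →L[ℝ] E3, (∀ x, inner ℝ (A x) x = 0) ∧ A ≠ 0 := by
  set e₀ : E3 := EuclideanSpace.single 0 1 with he₀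
  set e₁ : E3 := EuclideanSpace.single 1 1 with he₁
  refine ⟨(innerSL ℝ e₀).smulRight e₁ - (innerSL ℝ e₁).smulRight e₀, fun x => ?_, fun h => ?_⟩
  · simp only [sub_apply, ContinuousLinearMap.smulRight_apply, innerSL_apply_apply,
      inner_sub_left, real_inner_smul_left]
    ring
  · have h1 := congrArg (fun T : E3 →L[ℝ] E3 => (T e₀) 1) h
    simp [he₀, he₁, innerSL_apply_apply, EuclideanSpace.inner_single_left] at h1

/-! ## §4 The support S-U -/

/-- **S-U «COMMON AXIS» holds** (`WindowAxisUniform` of the VIRIAL HORN line, verbatim g10-1 / g11-1): in an open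
preconnected window of a jointly continuous, locally bounded Oseen-mild field whose every slice is axisymmetric about
some axis through `x₀`, one skew generator `A ≠ 0` serves every slice.  Proof: the symmetry algebras `𝔞_t` (skew `A`
with `D(u t)·A(· − x₀) = A u t`) increase with `t` — an infinitesimal symmetry of the differentiable slice `u s`
integrates to the finite symmetries `e^{θA}` (linear isometries for skew `A`), which the forward uniqueness of bounded
mild solutions transports to every later slice, where they differentiate back — and are all non-zero, so the one of
least dimension lies in all of them.  A support of one RUNG line; `UnthreadedRigidity` (27585), W2 and NS regularity
stay OPEN. [cite: KochNadirashviliSereginSverak2009, §4 (arXiv:0709.3599 p. 8); MajdaBertozziCUP2002, §1.2 Prop. 1.1 (iii)] -/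
theorem windowAxisUniform_holds : WindowAxisUniform := by
  intro S hS hconn u x₀ hcont _hdiv hmild hbdd hax
  classical
  rcases S.eq_empty_or_nonempty with hSe | hne
  · obtain ⟨A, hAskew, hAne⟩ := exists_skew_ne_zero
    refine ⟨A, hAskew, hAne, fun t ht => ?_⟩
    rw [hSe] at ht
    exact absurd ht (notMem_empty t)
  choose 𝔞 h𝔞 using fun t : ℝ => exists_symAlg (u t) x₀
  have hdiff : ∀ t ∈ S, Differentiable ℝ (u t) := fun t ht =>
    window_differentiable_slice hS hcont hmild hbdd ht
  have hmono : ∀ s ∈ S, ∀ t ∈ S, s ≤ t → 𝔞 s ≤ 𝔞 t := by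
    intro s hs t ht hst A hA
    rw [h𝔞] at hA ⊢
    rcases hst.eq_or_lt with h | h
    · subst h
      exact hA
    refine ⟨hA.1, fderiv_eq_of_equivariant_exp (hdiff t ht) fun θ y => ?_⟩
    obtain ⟨L, -, hL⟩ := rss_exists_rot (E := E3) hA.1 θ
    have hsymS : ∀ y, u s (L.symm y + x₀) = L.symm (u s (y + x₀)) := fun y => by
      rw [hL, hL]
      exact equivariant_exp_of_fderiv (hdiff s hs) hA.2 θ y
    have key := window_equivariance_transport hS hconn hcont hmild hbdd L.symm hs ht h hsymS y
    rwa [hL, hL] at key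
  obtain ⟨t₀, ht₀, hmin⟩ := exists_submodule_le_all hne 𝔞 hmono
  obtain ⟨A, hAskew, hAne, hAeq⟩ := hax t₀ ht₀
  have hA₀ : A ∈ 𝔞 t₀ := (h𝔞 t₀ A).2 ⟨hAskew, hAeq⟩
  refine ⟨A, hAskew, hAne, fun t ht => ?_⟩
  exact ((h𝔞 t A).1 (hmin t ht hA₀)).2

end Summit.NavierStokesRegularity.NavierStokesRegularity.Theorems.UnthreadedRigidity.VirialHorn
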